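import Summits.BirchSwinnertonDyer.BirchSwinnertonDyer.Theorems.Rank1ResidualJetKolyvaginClassOrder
import Summits.BirchSwinnertonDyer.BirchSwinnertonDyer.Theorems.ClassRecordThreeEulerHalvesAtThreeJetchevTight
import Summits.BirchSwinnertonDyer.BirchSwinnertonDyer.Theorems.ClassRecordThreeEulerHalvesAtThreeSection6Bridge
import Literature.NumberTheory.EllipticCurves.Jetchev2008.SelmerStructures
import HarnessLib

/-!
# S7♯ of the Jetchev walk, ALGEBRAIC HALF: the class `κ̃ = c_k(P_m ∕ p^u)` with `κ = p^u • κ̃` and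
# `ord κ̃ = p^k` for the concrete Kolyvagin classes (cell `bsd-stepL`, seat `bsd-stepL-tam3-p1`,
# helper toward item 19109 `EulerHalvesAtThree`, registered stub `stub_jetchevMaxHLAtThree`)

HONEST FRAMING. Nothing here proves BSD, J₃ or any divisibility of a Heegner point; the registered stub
is NOT discharged; no item closes; 0 classes move (T7); `--supports stmt-BirchSwinnertonDyer-19109`
(helper). WHAT THIS FILE DOES. The walk `Koly.tamagawaExponent_le_m_of_admissibleFamilies`
(`…WalkFamiliesAdm`, p497855) has the named input `hκt` = [J] §3.1 item 7: at a conductor `m` with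
`m(m) + k ≤ M(m)` there is `κ̃` with `κ_{m,k} = p^{m(m)} κ̃`, `ord κ̃ = p^k`, on the `ε(m)` side of
`H_{𝓕(m)}`. Its ALGEBRAIC half is proved here for the tree's cocycle classes:
`exists_tildeClass_of_exactDepth` — for a Kolyvagin–Heegner datum `d` of conductor `n` with
`p^u ∥ P_n`, admissibility of `E(K[n]) ⊆ E(K̄)` for `p^{k+u}` and `Γ_K`-invariance of `[P_n]` mod
`p^{k+u}` (the standing inputs at the DEEPER level `k + u ≤ M(n)`), the point `Q = P_n ∕ p^u ∈ E(K[n])`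
has `[Q]` invariant mod `p^k`, McCallum's class `κ̃ := c(Q) ∈ H¹(K, E[p^k])` (the tree's general
`kolyvaginClass` of a point) has order EXACTLY `p^k`, and `c_k(n) = p^u • κ̃` (`cls_zsmul`). With the
standing inputs supplied as in bsd-jet pv-2's `Rank1ResidualJetKolyvaginClassOrder` (`ρ̄_{E,p}` onto;
data at the divisors): `exists_tildeClass_of_exactDepth_of_surj`. What REMAINS of `hκt` after this
file is the membership `κ̃ ∈ (H_{𝓕(n)})^{ε(n)}` — the Selmer local conditions of [J] Prop. 4.5–4.6 and
the sign of Gross Prop. 5.4 for the class of `Q` — stated in `hκt_of_tildeSelmer` as the hypothesis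
`hsel` on the classes `c(Q)` of ALL `p^u`-th roots `Q` of `P_n` in `E(K[n])`.
References (locators only; no cited FACT declared): [cite: Jetchev2008, §3.1 item 7 (p. 817),
§4.1.4 (p. 818), proof of Thm. 5.2 (p. 822: "κ_{c,m} = p^{m(c)} κ̃")] [cite: McCallumLMS1991, §4 (4)–(6),
Lemma 4.1, Cor. 4.5] [cite: GrossLMS1991, §4 (4.4), Prop. 4.7 (1)]. Design: theorems only; `K : Type`.
Axioms: `propext`, `Classical.choice`, `Quot.sound`.
-/

set_option autoImplicit false

noncomputable section

open scoped Classical NumberField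

namespace Summit.BirchSwinnertonDyer.Rank1Residual.X11b.Three.Koly

open WeierstrassCurve IsDedekindDomain NumberField Field Literature.NumberTheory.EllipticCurves
  Literature.NumberTheory.EllipticCurves.ModularForms Literature.NumberTheory.EllipticCurves.KolyvaginCocycle
  Literature.NumberTheory.EllipticCurves.Jetchev2008 Literature.NumberTheory.GaloisRepresentations
  Summit.BirchSwinnertonDyer.Rank1Residual.X11b Summit.BirchSwinnertonDyer.Rank1Residual.JET

variable {K : Type} [Field K] [NumberField K] {N : ℕ} [NeZero N] {W : WeierstrassCurve ℚ}
  {Dt : ModularParametrizationData W N} {β : ℤ} {ι : K →+* ℂ} {n : ℕ}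

/-- **[J] §3.1 item 7, algebraic half: `κ̃` exists, `κ = p^u • κ̃`, `ord κ̃ = p^k`.** For a datum `d` of
conductor `n`, a level `k ≥ 1`, an exponent `u` with `p^u ∥ P_n`, and the standing inputs at level
`p^{k+u}` (`hA`: `E(K[n]) ⊆ E(K̄)` admissible for `p^{k+u}`; `hP`: `[P_n]` `Γ_K`-invariant mod
`p^{k+u}`): there are a point `Q ∈ E(K[n])` with `p^u • Q = P_n`, whose image is `Γ_K`-invariant mod
`p^k` (for the admissible structure at level `p^k`), such that McCallum's class `κ̃ := c(Q) ∈ H¹(K, E[p^k])`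
has order `p^k` and `c_k(n) = p^u • κ̃`. [cite: Jetchev2008, §3.1 item 7 (p. 817), §5.2 (p. 822)]
[cite: McCallumLMS1991, §4 (6), Cor. 4.5] -/
theorem exists_tildeClass_of_exactDepth (d : KolyvaginHeegnerData Dt β ι n) {p : ℕ} (hp : p.Prime)
    {k u : ℕ} (hk : 1 ≤ k)
    (hA : IsAdmissible (absoluteGaloisGroup K) d.pointsSubgroup ((p ^ (k + u) : ℕ) : ℤ))
    (hP : d.toGeomPoints d.derivedPoint ∈
      invPoints (absoluteGaloisGroup K) d.pointsSubgroup ((p ^ (k + u) : ℕ) : ℤ))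
    (hdvd : ∃ Q : (W.baseChange (ringClassField K ι n)).toAffine.Point,
      ((p ^ u : ℕ) : ℤ) • Q = d.derivedPoint)
    (hndvd : ¬ ∃ Q : (W.baseChange (ringClassField K ι n)).toAffine.Point,
      ((p ^ (u + 1) : ℕ) : ℤ) • Q = d.derivedPoint) :
    ∃ (hAk : IsAdmissible (absoluteGaloisGroup K) d.pointsSubgroup ((p ^ k : ℕ) : ℤ))
      (Q : (W.baseChange (ringClassField K ι n)).toAffine.Point)
      (hQ : d.toGeomPoints Q ∈ invPoints (absoluteGaloisGroup K) d.pointsSubgroup ((p ^ k : ℕ) : ℤ)),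
      ((p ^ u : ℕ) : ℤ) • Q = d.derivedPoint ∧
      addOrderOf (kolyvaginClass (W.baseChange K) ((p ^ k : ℕ) : ℤ)
        ((W.baseChange K).zsmul_geomPoints_surjective_of_charZero
          (by exact_mod_cast pow_ne_zero k hp.ne_zero)) hAk (d.toGeomPoints Q) hQ) = p ^ k ∧
      d.kolyvaginClass hp k = ((p ^ u : ℕ) : ℤ) •
        kolyvaginClass (W.baseChange K) ((p ^ k : ℕ) : ℤ)
          ((W.baseChange K).zsmul_geomPoints_surjective_of_charZero
            (by exact_mod_cast pow_ne_zero k hp.ne_zero)) hAk (d.toGeomPoints Q) hQ := by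
  haveI : Fact p.Prime := ⟨hp⟩
  -- torsion-freeness read off `hA`
  have htf : ∀ (i : ℕ), i ≤ k + u → ∀ a ∈ d.pointsSubgroup, ((p ^ i : ℕ) : ℤ) • a = 0 → a = 0 := by
    intro i hi a ha h0
    refine hA.eq_zero_of_zsmul ha ?_
    obtain ⟨r, hr⟩ := Nat.exists_eq_add_of_le hi
    rw [hr, add_comm, natCast_pow_add_eq_mul, mul_smul, h0, smul_zero]
  -- admissibility at level `p^k`
  have hAk : IsAdmissible (absoluteGaloisGroup K) d.pointsSubgroup ((p ^ k : ℕ) : ℤ) :=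
    ⟨hA.smul_mem, fun a ha h0 ↦ htf k (Nat.le_add_right k u) a ha h0⟩
  obtain ⟨Q, hQP⟩ := hdvd
  have hQA : d.toGeomPoints Q ∈ d.pointsSubgroup := ⟨Q, rfl⟩
  -- `[Q]` is invariant mod `p^k`: `(g-1)P = p^{k+u} R` and `(g-1)P = p^u (g-1)Q` give `(g-1)Q = p^k R`
  have hQinv : d.toGeomPoints Q ∈ invPoints (absoluteGaloisGroup K) d.pointsSubgroup ((p ^ k : ℕ) : ℤ) := by
    refine ⟨hQA, fun g ↦ ?_⟩
    obtain ⟨R, hR, hRe⟩ := hP.2 g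
    refine ⟨R, hR, ?_⟩
    have hPeq : d.toGeomPoints d.derivedPoint = ((p ^ u : ℕ) : ℤ) • d.toGeomPoints Q := by
      rw [← map_zsmul, hQP]
    have h1 : ((p ^ u : ℕ) : ℤ) • (((p ^ k : ℕ) : ℤ) • R - (g • d.toGeomPoints Q - d.toGeomPoints Q)) = 0 := by
      rw [smul_sub, smul_smul, ← natCast_pow_add_eq_mul, Nat.add_comm u k, hRe, hPeq, smul_sub,
        smul_zsmul_comm, sub_self]
    have hmem : ((p ^ k : ℕ) : ℤ) • R - (g • d.toGeomPoints Q - d.toGeomPoints Q) ∈ d.pointsSubgroup :=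
      d.pointsSubgroup.sub_mem (d.pointsSubgroup.zsmul_mem hR _)
        (d.pointsSubgroup.sub_mem (hA.smul_mem g hQA) hQA)
    exact sub_eq_zero.mp (htf u (Nat.le_add_left u k) _ hmem h1)
  -- invariance of `[P_n]` mod `p^k`
  have hPk : d.toGeomPoints d.derivedPoint ∈
      invPoints (absoluteGaloisGroup K) d.pointsSubgroup ((p ^ k : ℕ) : ℤ) := by
    have : d.toGeomPoints d.derivedPoint = ((p ^ u : ℕ) : ℤ) • d.toGeomPoints Q := by
      rw [← map_zsmul, hQP]
    rw [this]
    exact AddSubgroup.zsmul_mem _ hQinv _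
  set hdiv := (W.baseChange K).zsmul_geomPoints_surjective_of_charZero
    (n := ((p ^ k : ℕ) : ℤ)) (by exact_mod_cast pow_ne_zero k hp.ne_zero) with hdiv_def
  -- a `p^k`-th root `R₀` of `Q` in `E(K̄)`; then `p^u • R₀` is a `p^k`-th root of `P_n`
  obtain ⟨R₀, hR₀⟩ := hdiv (d.toGeomPoints Q)
  simp only at hR₀
  have huP : ((p ^ u : ℕ) : ℤ) • d.toGeomPoints Q ∈
      invPoints (absoluteGaloisGroup K) d.pointsSubgroup ((p ^ k : ℕ) : ℤ) :=
    AddSubgroup.zsmul_mem _ hQinv _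
  have huQ : ((p ^ k : ℕ) : ℤ) • (((p ^ u : ℕ) : ℤ) • R₀) = ((p ^ u : ℕ) : ℤ) • d.toGeomPoints Q := by
    rw [smul_comm, hR₀]
  refine ⟨hAk, Q, hQinv, hQP, ?_, ?_⟩
  · -- order exactly `p^k`
    obtain ⟨k', rfl⟩ : ∃ k', k = k' + 1 := ⟨k - 1, by omega⟩
    refine addOrderOf_eq_prime_pow (fun h0 ↦ hndvd ?_) ?_
    · -- `p^{k'} • c(Q) = c(p^{k'} Q) = 0` gives `p^{k'} Q ∈ p^{k'+1} E(K[n])`, so `Q ∈ p E(K[n])`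
      have hk'P : ((p ^ k' : ℕ) : ℤ) • d.toGeomPoints Q ∈
          invPoints (absoluteGaloisGroup K) d.pointsSubgroup ((p ^ (k' + 1) : ℕ) : ℤ) :=
        AddSubgroup.zsmul_mem _ hQinv _
      have hk'Q : ((p ^ (k' + 1) : ℕ) : ℤ) • (((p ^ k' : ℕ) : ℤ) • R₀) =
          ((p ^ k' : ℕ) : ℤ) • d.toGeomPoints Q := by rw [smul_comm, hR₀]
      rw [← natCast_zsmul, kolyvaginClass_eq_cls hAk hQinv hR₀,
        ← cls_zsmul hAk (continuous_smul_geomPoints _) hQinv hR₀ _ hk'P hk'Q,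
        cls_eq_zero_iff hAk _ hk'P hk'Q
          (N := {g : absoluteGaloisGroup K | ∀ x : ringClassField K ι n,
            (show AlgebraicClosure K ≃ₐ[K] AlgebraicClosure K from g) (d.emb x) = d.emb x})
          (fun g hg ↦ by
            rw [← map_zsmul]
            exact KolyCert.smul_toGeomPoints_of_forall_emb d g hg _)
          (fun v hv ↦ KolyCert.mem_pointsSubgroup_of_forall_smul_eq d v fun g hg ↦ hv g hg)] at h0
      obtain ⟨_, ⟨B, rfl⟩, hB⟩ := h0
      -- `p^{k'+1} B = p^{k'} Q`, so `p^{k'} (p B - Q) = 0`, so `Q = p B`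
      have h1 : ((p ^ k' : ℕ) : ℤ) • (((p ^ 1 : ℕ) : ℤ) • B - Q) = 0 := by
        apply Affine.Point.map_injective (W' := W) d.emb.toRatAlgHom
        change d.toGeomPoints _ = d.toGeomPoints 0
        rw [map_zero, map_zsmul, map_sub, map_zsmul, smul_sub, smul_smul, ← natCast_pow_add_eq_mul,
          hB, sub_self]
      have h2 : ((p ^ 1 : ℕ) : ℤ) • B - Q = 0 :=
        eq_zero_of_pow_zsmul_eq_zero_of_isAdmissible d (k' + 1) hAk (by omega) _ h1
      refine ⟨B, ?_⟩
      rw [← hQP, ← sub_eq_zero.mp h2, smul_smul, ← natCast_pow_add_eq_mul, add_comm]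
    · -- `p^{k'+1}` kills `H¹(K, E[p^{k'+1}])`
      exact galoisCohomology.nsmul_eq_zero_of_forall
        ((W.baseChange K).torsionGaloisModule ((p ^ (k' + 1) : ℕ) : ℤ))
        (fun T ↦ by
          have h := (W.baseChange K).natAbs_nsmul_geomTorsion T
          rwa [Int.natAbs_natCast] at h) _
  · -- `c_k(n) = p^u • c(Q)` (`cls_zsmul` and independence of the root)
    rw [d.kolyvaginClass_of_admissible hp k hAk hPk, kolyvaginClass_eq_cls hAk hQinv hR₀,
      ← cls_zsmul hAk (continuous_smul_geomPoints _) hQinv hR₀ _ huP huQ]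
    have hPeq : d.toGeomPoints d.derivedPoint = ((p ^ u : ℕ) : ℤ) • d.toGeomPoints Q := by
      rw [← map_zsmul, hQP]
    have hrootP : ((p ^ k : ℕ) : ℤ) • (((p ^ u : ℕ) : ℤ) • R₀) = d.toGeomPoints d.derivedPoint := by
      rw [huQ, hPeq]
    rw [kolyvaginClass_eq_cls hAk hPk hrootP]
    exact cls_congr hAk _ hPeq rfl

/-- **The same with BOTH standing inputs supplied** (as in bsd-jet's `Rank1ResidualJetKolyvaginClassOrder`
§3): admissibility for `p^{k+u}` from `ρ̄_{E,p}` onto at an odd `p` (`RingClassNoTorsion.isAdmissible_pointsSubgroup`)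
and the invariance of `[P_n]` mod `p^{k+u}` from data at every divisor of `n` with all prime factors
Kolyvagin of index `≥ k + u` (`KolyCert.toGeomPoints_derivedPoint_mem_invPoints_of_dvd_zhang`; `K`
imaginary quadratic, `(N, d_K) = 1`, `d_K < −4`). [cite: Jetchev2008, §3.1 item 7 (p. 817)]
[cite: McCallumLMS1991, §4 (4)–(6)] [cite: GrossLMS1991, Prop. 3.6, Lemma 4.3] -/
theorem exists_tildeClass_of_exactDepth_of_surj [W.IsElliptic] [W.IsGloballyMinimal]
    (hK : IsImaginaryQuadratic K) (hND : IsCoprime (N : ℤ) (NumberField.discr K))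
    (hD : NumberField.discr K < -4) {p : ℕ} (hp : p.Prime) (hp2 : p ≠ 2)
    (hρ : W.HasSurjectiveModNGaloisRep p) {k u : ℕ} (hk : 1 ≤ k) (hn : Squarefree n)
    (hkol : ∀ q ∈ n.primeFactors,
      Zhang2014.IsKolyvaginPrime N W K p q ∧ k + u ≤ Zhang2014.kolyvaginIndex W p q)
    (data : (m : ℕ) → m ∣ n → KolyvaginHeegnerData Dt β ι m)
    (hdvd : ∃ Q : (W.baseChange (ringClassField K ι n)).toAffine.Point,
      ((p ^ u : ℕ) : ℤ) • Q = (data n dvd_rfl).derivedPoint)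
    (hndvd : ¬ ∃ Q : (W.baseChange (ringClassField K ι n)).toAffine.Point,
      ((p ^ (u + 1) : ℕ) : ℤ) • Q = (data n dvd_rfl).derivedPoint) :
    ∃ (hAk : IsAdmissible (absoluteGaloisGroup K) (data n dvd_rfl).pointsSubgroup ((p ^ k : ℕ) : ℤ))
      (Q : (W.baseChange (ringClassField K ι n)).toAffine.Point)
      (hQ : (data n dvd_rfl).toGeomPoints Q ∈
        invPoints (absoluteGaloisGroup K) (data n dvd_rfl).pointsSubgroup ((p ^ k : ℕ) : ℤ)),
      ((p ^ u : ℕ) : ℤ) • Q = (data n dvd_rfl).derivedPoint ∧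
      addOrderOf (kolyvaginClass (W.baseChange K) ((p ^ k : ℕ) : ℤ)
        ((W.baseChange K).zsmul_geomPoints_surjective_of_charZero
          (by exact_mod_cast pow_ne_zero k hp.ne_zero)) hAk ((data n dvd_rfl).toGeomPoints Q) hQ) =
        p ^ k ∧
      (data n dvd_rfl).kolyvaginClass hp k = ((p ^ u : ℕ) : ℤ) •
        kolyvaginClass (W.baseChange K) ((p ^ k : ℕ) : ℤ)
          ((W.baseChange K).zsmul_geomPoints_surjective_of_charZero
            (by exact_mod_cast pow_ne_zero k hp.ne_zero)) hAk ((data n dvd_rfl).toGeomPoints Q) hQ :=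
  exists_tildeClass_of_exactDepth _ hp hk
    (RingClassNoTorsion.isAdmissible_pointsSubgroup _ hK hn.ne_zero hp hp2 hρ (k + u))
    (KolyCert.toGeomPoints_derivedPoint_mem_invPoints_of_dvd_zhang hK ι Dt hp hND hD hn hkol data n
      dvd_rfl)
    hdvd hndvd

/-- **The walk's `hκt` from the Selmer membership of the classes of the `p^u`-th roots.** For data `D`
on the admissible-conductor subtype (level `k ≥ 1`), the hypothesis `hκt` of
`Koly.tamagawaExponent_le_m_of_admissibleFamilies` follows from `hsel`: for every admissible `s` and
every `Q ∈ E(K[s])` with `p^u • Q = P_s`, `p^{u+1} ∤ P_s` and `[Q]` invariant mod `p^k`, McCallum's class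
`c(Q) ∈ H¹(K, E[p^k])` lies in `(H_{𝓕(s)})^{ε(s)}` — the Selmer local conditions of [J] Prop. 4.5–4.6
with the transverse ones, and the sign of Gross Prop. 5.4, for the class of `Q` (NAMED, not proved
here). Frame: `K` imaginary quadratic, `(N_E, d_K) = 1`, `d_K < −4`, `p` odd, `ρ̄_{E,p}` onto.
[cite: Jetchev2008, §3.1 item 7 (p. 817), Prop. 4.5–4.6 (pp. 819–820)] [cite: GrossLMS1991, Prop. 5.4] -/
theorem hκt_of_tildeSelmer (W : WeierstrassCurve ℚ) [W.IsElliptic] [W.IsGloballyMinimal]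
    [NeZero (W.conductorNorm ℤ)] (hK : IsImaginaryQuadratic K)
    (hND : IsCoprime ((W.conductorNorm ℤ : ℕ) : ℤ) (NumberField.discr K)) (hD : NumberField.discr K < -4)
    {p : ℕ} [Fact p.Prime] (hp2 : p ≠ 2) (hρ : W.HasSurjectiveModNGaloisRep p)
    (Dt : ModularParametrizationData W (W.conductorNorm ℤ)) (β : ℤ) (ι : K →+* ℂ) (τ : K ≃ₐ[ℚ] K)
    {k : ℕ} (hk : 1 ≤ k)
    (𝒯 : Literature.NumberTheory.GaloisRepresentations.DiscreteGaloisModule.SelmerStructure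
      ((W.baseChange K).torsionGaloisModule ((p ^ k : ℕ) : ℤ)))
    (D : ∀ s : {m : ℕ // Squarefree m ∧ ∀ q ∈ m.primeFactors,
        Zhang2014.IsKolyvaginPrime (W.conductorNorm ℤ) W K p q ∧ k ≤ Zhang2014.kolyvaginIndex W p q},
      KolyvaginHeegnerData Dt β ι s.1)
    (eb : ℕ → Bool) (hdivfin : ∀ s, Zhang2014.levelIndex W p s.1 = ⊤ → divOrd (D s) p ≠ ⊤)
    (hsel : ∀ s (u : ℕ) (Q : (W.baseChange (ringClassField K ι s.1)).toAffine.Point)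
      (hAk : IsAdmissible (absoluteGaloisGroup K) (D s).pointsSubgroup ((p ^ k : ℕ) : ℤ))
      (hQ : (D s).toGeomPoints Q ∈ invPoints (absoluteGaloisGroup K) (D s).pointsSubgroup ((p ^ k : ℕ) : ℤ)),
      ((p ^ u : ℕ) : ℤ) • Q = (D s).derivedPoint →
      (¬ ∃ Q' : (W.baseChange (ringClassField K ι s.1)).toAffine.Point,
        ((p ^ (u + 1) : ℕ) : ℤ) • Q' = (D s).derivedPoint) →
      ((u + k : ℕ) : ℕ∞) ≤ Zhang2014.levelIndex W p s.1 →
      (kolyvaginClass (W.baseChange K) ((p ^ k : ℕ) : ℤ)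
        ((W.baseChange K).zsmul_geomPoints_surjective_of_charZero
          (by exact_mod_cast pow_ne_zero k (Fact.out : p.Prime).ne_zero)) hAk ((D s).toGeomPoints Q) hQ :
          galoisCohomology ((W.baseChange K).torsionGaloisModule ((p ^ k : ℕ) : ℤ)) 1) ∈
        signPart W K τ ((p ^ k : ℕ) : ℤ) (if eb s.1 then 1 else -1)
          (selmerF W ((p ^ k : ℕ) : ℤ) 𝒯 (placesDividing K s.1)).selmerGroup) :
    ∀ s, (if divOrd (D s) p < Zhang2014.levelIndex W p s.1 then divOrd (D s) p else (⊤ : ℕ∞)) +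
        (k : ℕ∞) ≤ Zhang2014.levelIndex W p s.1 →
      ∃ x : galoisCohomology ((W.baseChange K).torsionGaloisModule ((p ^ k : ℕ) : ℤ)) 1,
        x ∈ signPart W K τ ((p ^ k : ℕ) : ℤ) (if eb s.1 then 1 else -1)
          (selmerF W ((p ^ k : ℕ) : ℤ) 𝒯 (placesDividing K s.1)).selmerGroup ∧
        addOrderOf x = p ^ k ∧
        ((D s).kolyvaginClass (Fact.out : p.Prime) k :
            galoisCohomology ((W.baseChange K).torsionGaloisModule ((p ^ k : ℕ) : ℤ)) 1) =
          p ^ (if divOrd (D s) p < Zhang2014.levelIndex W p s.1 then divOrd (D s) p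
            else (⊤ : ℕ∞)).toNat • x := by
  have hp : p.Prime := Fact.out
  intro s hs
  by_cases hlt : divOrd (D s) p < Zhang2014.levelIndex W p s.1
  · rw [if_pos hlt] at hs ⊢
    -- `ord_p(P_s) = u` is finite; exact depth `p^u ∥ P_s`
    have hne : divOrd (D s) p ≠ ⊤ := ne_top_of_lt hlt
    obtain ⟨u, hu⟩ : ∃ u : ℕ, divOrd (D s) p = u := ⟨_, (ENat.coe_toNat hne).symm⟩
    rw [hu] at hs hlt ⊢
    simp only [ENat.toNat_coe]
    have hdvd : PDiv (D s) p u := pDiv_of_le_divOrd _ _ _ (le_of_eq hu.symm)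
    have hndvd : ¬ PDiv (D s) p (u + 1) := fun h ↦ by
      have h' := le_divOrd_of_pDiv (p := p) (D s) h
      rw [hu] at h'
      exact absurd (by exact_mod_cast h' : u + 1 ≤ u) (by omega)
    have huk : ((u + k : ℕ) : ℕ∞) ≤ Zhang2014.levelIndex W p s.1 := by push_cast; exact hs
    have hkol : ∀ q ∈ s.1.primeFactors,
        Zhang2014.IsKolyvaginPrime (W.conductorNorm ℤ) W K p q ∧ k + u ≤ Zhang2014.kolyvaginIndex W p q :=
      fun q hq ↦ ⟨(s.2.2 q hq).1, by
        rw [Nat.add_comm]; exact Zhang2014.natCast_le_levelIndex_iff.mp huk q hq⟩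
    -- data at the divisors of `s` (admissible at level `k`)
    have hdiv : ∀ m : ℕ, m ∣ s.1 → Squarefree m ∧ ∀ q ∈ m.primeFactors,
        Zhang2014.IsKolyvaginPrime (W.conductorNorm ℤ) W K p q ∧ k ≤ Zhang2014.kolyvaginIndex W p q :=
      fun m hm ↦ ⟨s.2.1.squarefree_of_dvd hm, fun q hq ↦
        s.2.2 q (Nat.primeFactors_mono hm s.2.1.ne_zero hq)⟩
    obtain ⟨hAk, Q, hQ, hQP, hord, hκ⟩ := exists_tildeClass_of_exactDepth_of_surj (Dt := Dt) (β := β)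
      hK hND hD hp hp2 hρ hk s.2.1 hkol (fun m hm ↦ D ⟨m, hdiv m hm⟩) hdvd hndvd
    refine ⟨_, hsel s u Q hAk hQ hQP hndvd huk, hord, ?_⟩
    rw [← natCast_zsmul]
    exact hκ
  · -- `m(s) = ⊤`: then `M(s) = ⊤`, so `s = 1`-type conductor, and `ord_p(P_s)` is finite — contradiction
    rw [if_neg hlt, top_add, top_le_iff] at hs
    exact (hlt (lt_of_lt_of_eq (lt_top_iff_ne_top.mpr (hdivfin s hs)) hs.symm)).elim

end Summit.BirchSwinnertonDyer.Rank1Residual.X11b.Three.Koly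

end
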